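import Summits.Ventures.Crystal3D.Bulk.RotSysCorners
import HarnessLib

/-!
# Deleting one edge from a weighted sub-rotation-system: faces away from the edge, and the
# corner sum near the edge (generic brick for P-L3(b) L1, `phase2/LEAN-FACES-DESIGN.md` §5.6 (i))

HONEST FRAMING. Part of the venture `Summits/Ventures/Crystal3D` (cell `pub-crystal3d`, phase 2;
seat p3), PURELY COMBINATORIAL and generic (folklore): no geometry. For a loopless rotation
system `(σ, α)` with weights `w`, an `α`-closed `S ∋ d` and the deleted edge `{d, α d}`
(`Bulk/RotSysCorners.lean` for `cornerAt`, `face`, `faceSum`, `excess`):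

* **`IsRotSys.face_sdiff_of_not_sameCycle` / `faceSum_sdiff_of_not_sameCycle` /
  `excess_sdiff_of_not_sameCycle`** — a face of `S` through neither `d` nor `α d` is a face of
  `S ∖ {d, α d}` with the same darts, corner sum and excess;
* **`IsRotSys.sum_cornerAt_sdiff_U`** — on `U = (face d ∪ face (α d)) ∖ {d, α d}` the corner sum
  of `S ∖ {d, α d}` is that of `S` over `face d ∪ face (α d)`, minus the corner of `d` (resp.
  `α d`) when that dart is ALONE at its vertex (pendant end: its corner is the full vertex);
* `sameCycle_iff_swap_mul_or` — splitting a cycle by a transposition, union form (complement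
  to `Bulk/RotSysSwap.lean`).

The MERGE/SPLIT identities for the excess are in `Bulk/RotSysFaceGlue.lean`. Nothing here mentions
GAP(1.26).
-/

namespace Summit.Ventures.Crystal3D

namespace RotSys

open Equiv Equiv.Perm Finset

variable {D : Type*} [DecidableEq D] [Fintype D]

/-! ## Deleting one edge: faces away from the edge are untouched -/

section FaceSdiff

open scoped Classical

variable {σ α : Perm D} {S : Finset D} {d : D}

/-- On a surviving dart whose `S`-face-successor is neither `d` nor `α d`, the face permutation
of `S ∖ {d, α d}` agrees with that of `S`. -/
theorem IsRotSys.phi_sdiff_apply_of_ne (h : IsRotSys σ α) (hS : IsClosed α S) (hd : d ∈ S)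
    {x : D} (hx : x ∈ S \ {d, α d}) (h1 : phi σ α S x ≠ d) (h2 : phi σ α S x ≠ α d) :
    phi σ α (S \ {d, α d}) x = phi σ α S x := by
  rw [h.phi_sdiff_apply hS hd hx, if_neg h1, if_neg h2]

/-- … and so does the corner met after it. -/
theorem IsRotSys.cornerAt_sdiff_alpha_of_ne (h : IsRotSys σ α) (hS : IsClosed α S) (hd : d ∈ S)
    (w : D → ℝ) {x : D} (hx : x ∈ S \ {d, α d}) (h1 : phi σ α S x ≠ d)
    (h2 : phi σ α S x ≠ α d) :
    cornerAt σ w (S \ {d, α d}) (α x) = cornerAt σ w S (α x) := by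
  have hαx : α x ∈ S \ {d, α d} := isClosed_sdiff_pair h hS d x hx
  rw [phi_apply] at h1 h2
  rw [h.cornerAt_sdiff hS hd w hαx, if_neg h1, if_neg h2, add_zero, add_zero]

/-- **A face of `S` through neither `d` nor `α d` is a face of `S ∖ {d, α d}`** (same darts). -/
theorem IsRotSys.face_sdiff_of_not_sameCycle (h : IsRotSys σ α) (hS : IsClosed α S)
    (hd : d ∈ S) {y : D} (hy : y ∈ S) (hyd : ¬ (phi σ α S).SameCycle d y)
    (hyα : ¬ (phi σ α S).SameCycle (α d) y) :
    face σ α (S \ {d, α d}) y = face σ α S y := by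
  set T := face σ α S y with hT
  -- every dart of the `S`-face of `y` survives, and its successor avoids `d`, `α d`
  have hTmem : ∀ z ∈ T, z ∈ S \ {d, α d} := by
    intro z hz
    obtain ⟨hzS, hc⟩ := mem_face.1 hz
    refine mem_sdiff_pair_iff.2 ⟨hzS, ?_, ?_⟩
    · rintro rfl; exact hyd hc.symm
    · rintro rfl; exact hyα hc.symm
  have hTsucc : ∀ z ∈ T, phi σ α S z ≠ d ∧ phi σ α S z ≠ α d := by
    intro z hz
    obtain ⟨-, hc⟩ := mem_face.1 hz
    have hc' : (phi σ α S).SameCycle y (phi σ α S z) := hc.trans ⟨1, by simp⟩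
    exact ⟨fun e => hyd (by rw [← e]; exact hc'.symm), fun e => hyα (by rw [← e]; exact hc'.symm)⟩
  have hfg : ∀ z ∈ T, phi σ α (S \ {d, α d}) z = phi σ α S z := fun z hz =>
    h.phi_sdiff_apply_of_ne hS hd (hTmem z hz) (hTsucc z hz).1 (hTsucc z hz).2
  have hg : ∀ z ∈ T, phi σ α S z ∈ T := fun z hz =>
    mem_face.2 ⟨phi_apply_mem hS (mem_face.1 hz).1, (mem_face.1 hz).2.trans ⟨1, by simp⟩⟩
  have hf : ∀ z ∈ T, phi σ α (S \ {d, α d}) z ∈ T := fun z hz => by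
    rw [hfg z hz]; exact hg z hz
  have hyT : y ∈ T := mem_face_self hy
  ext z
  rw [mem_face, mem_face, sameCycle_iff_of_eqOn hfg hf hg hyT z]
  constructor
  · rintro ⟨hz, hc⟩; exact ⟨Finset.sdiff_subset hz, hc⟩
  · rintro ⟨hz, hc⟩; exact ⟨hTmem z (mem_face.2 ⟨hz, hc⟩), hc⟩

/-- … with the same corner sum, -/
theorem IsRotSys.faceSum_sdiff_of_not_sameCycle (h : IsRotSys σ α) (hS : IsClosed α S)
    (hd : d ∈ S) (w : D → ℝ) {y : D} (hy : y ∈ S) (hyd : ¬ (phi σ α S).SameCycle d y)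
    (hyα : ¬ (phi σ α S).SameCycle (α d) y) :
    faceSum σ α w (S \ {d, α d}) y = faceSum σ α w S y := by
  unfold faceSum
  rw [h.face_sdiff_of_not_sameCycle hS hd hy hyd hyα]
  refine Finset.sum_congr rfl fun z hz => ?_
  obtain ⟨hzS, hc⟩ := mem_face.1 hz
  have hc' : (phi σ α S).SameCycle y (phi σ α S z) := hc.trans ⟨1, by simp⟩
  have hz' : z ∈ S \ {d, α d} := by
    refine mem_sdiff_pair_iff.2 ⟨hzS, ?_, ?_⟩
    · rintro rfl; exact hyd hc.symm
    · rintro rfl; exact hyα hc.symm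
  exact h.cornerAt_sdiff_alpha_of_ne hS hd w hz'
    (fun e => hyd (by rw [← e]; exact hc'.symm)) (fun e => hyα (by rw [← e]; exact hc'.symm))

/-- … hence the same excess. -/
theorem IsRotSys.excess_sdiff_of_not_sameCycle (h : IsRotSys σ α) (hS : IsClosed α S)
    (hd : d ∈ S) (w : D → ℝ) {y : D} (hy : y ∈ S) (hyd : ¬ (phi σ α S).SameCycle d y)
    (hyα : ¬ (phi σ α S).SameCycle (α d) y) :
    excess σ α w (S \ {d, α d}) y = excess σ α w S y := by
  unfold excess
  rw [h.faceSum_sdiff_of_not_sameCycle hS hd w hy hyd hyα,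
    h.face_sdiff_of_not_sameCycle hS hd hy hyd hyα]

/-! ## Deleting one edge: the corner sum near the edge -/

/-- The `φ_S`-predecessor of `d` is `α` of the `σ_S`-predecessor: `φ_S y = d ↔ induce σ S (α y) = d`.
-/
theorem phi_eq_iff_induce_alpha_eq (σ α : Perm D) (S : Finset D) (y v : D) :
    phi σ α S y = v ↔ induce σ S (α y) = v := by rw [phi_apply]

/-- **The corner sum on `U = (face d ∪ face (α d)) ∖ {d, α d}` after deleting `{d, α d}`**: it is
the corner sum of `S` over `face d ∪ face (α d)`, minus the corner of `d` if `d` is alone at its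
vertex, minus the corner of `α d` if `α d` is alone at its vertex. -/
theorem IsRotSys.sum_cornerAt_sdiff_U (h : IsRotSys σ α) (hS : IsClosed α S) (hd : d ∈ S)
    (w : D → ℝ) :
    ∑ y ∈ (face σ α S d ∪ face σ α S (α d)) \ {d, α d}, cornerAt σ w (S \ {d, α d}) (α y) =
      ∑ y ∈ face σ α S d ∪ face σ α S (α d), cornerAt σ w S (α y) -
        (if induce σ S d = d then cornerAt σ w S d else 0) -
        (if induce σ S (α d) = α d then cornerAt σ w S (α d) else 0) := by
  set C := face σ α S d ∪ face σ α S (α d) with hC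
  have hαd : α d ∈ S := hS d hd
  have hne : α d ≠ d := h.α_ne d
  have hdC : d ∈ C := mem_union_left _ (mem_face_self hd)
  have hαC : α d ∈ C := mem_union_right _ (mem_face_self hαd)
  have hCS : C ⊆ S := union_subset (face_subset _ _ _ _) (face_subset _ _ _ _)
  -- the two predecessors
  set p₁ := (phi σ α S)⁻¹ d with hp₁
  set p₂ := (phi σ α S)⁻¹ (α d) with hp₂
  have hφp₁ : phi σ α S p₁ = d := Perm.eq_inv_iff_eq.1 hp₁
  have hφp₂ : phi σ α S p₂ = α d := Perm.eq_inv_iff_eq.1 hp₂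
  have hp₁S : p₁ ∈ S := by
    have := (phi_apply_mem_iff h hS p₁).1 (by rw [hφp₁]; exact hd)
    exact this
  have hp₂S : p₂ ∈ S := (phi_apply_mem_iff h hS p₂).1 (by rw [hφp₂]; exact hαd)
  have hp₁C : p₁ ∈ C := mem_union_left _ (mem_face.2 ⟨hp₁S, ⟨-1, by rw [zpow_neg_one, hp₁]⟩⟩)
  have hp₂C : p₂ ∈ C := mem_union_right _ (mem_face.2 ⟨hp₂S, ⟨-1, by rw [zpow_neg_one, hp₂]⟩⟩)
  have hp₁d : p₁ ≠ d := fun e => h.phi_ne_self S d (by rw [← e, hφp₁, e])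
  have hp₂α : p₂ ≠ α d := fun e => h.phi_ne_self S (α d) (by rw [← e, hφp₂, e])
  -- split the sum over `C ∖ {d, α d}` pointwise
  have hsplit : ∀ y ∈ C \ {d, α d}, cornerAt σ w (S \ {d, α d}) (α y) =
      cornerAt σ w S (α y) + (if y = p₁ then cornerAt σ w S d else 0) +
        (if y = p₂ then cornerAt σ w S (α d) else 0) := by
    intro y hy
    rw [Finset.mem_sdiff] at hy
    have hy' : y ∈ S \ {d, α d} := Finset.mem_sdiff.2 ⟨hCS hy.1, hy.2⟩
    have hαy : α y ∈ S \ {d, α d} := isClosed_sdiff_pair h hS d y hy'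
    rw [h.cornerAt_sdiff hS hd w hαy]
    have e1 : (induce σ S (α y) = d) ↔ y = p₁ := by
      rw [← phi_apply, hp₁, Perm.eq_inv_iff_eq]
    have e2 : (induce σ S (α y) = α d) ↔ y = p₂ := by
      rw [← phi_apply, hp₂, Perm.eq_inv_iff_eq]
    simp only [e1, e2]
  rw [Finset.sum_congr rfl hsplit, Finset.sum_add_distrib, Finset.sum_add_distrib,
    Finset.sum_ite_eq', Finset.sum_ite_eq']
  -- the plain part: remove `d` and `α d` from the sum over `C`
  have hpair : ({d, α d} : Finset D) ⊆ C := by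
    intro x hx
    rw [mem_insert, mem_singleton] at hx
    rcases hx with rfl | rfl
    · exact hdC
    · exact hαC
  have hplain : ∑ y ∈ C \ {d, α d}, cornerAt σ w S (α y) =
      ∑ y ∈ C, cornerAt σ w S (α y) - cornerAt σ w S (α d) - cornerAt σ w S d := by
    rw [← Finset.sum_sdiff hpair, Finset.sum_pair hne.symm, h.α_inv]
    ring
  rw [hplain]
  -- the indicator parts: `p₁ ∈ C ∖ e ↔ p₁ ≠ α d ↔ d not alone`, and symmetrically
  have i1 : p₁ ∈ C \ {d, α d} ↔ ¬ induce σ S d = d := by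
    rw [Finset.mem_sdiff, mem_insert, mem_singleton, not_or]
    have key : p₁ = α d ↔ induce σ S d = d := by
      rw [hp₁, Perm.inv_eq_iff_eq, eq_comm, phi_apply, h.α_inv]
    constructor
    · rintro ⟨-, -, hne'⟩ hfix; exact hne' (key.2 hfix)
    · intro hfix; exact ⟨hp₁C, hp₁d, fun e => hfix (key.1 e)⟩
  have i2 : p₂ ∈ C \ {d, α d} ↔ ¬ induce σ S (α d) = α d := by
    rw [Finset.mem_sdiff, mem_insert, mem_singleton, not_or]
    have key : p₂ = d ↔ induce σ S (α d) = α d := by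
      rw [hp₂, Perm.inv_eq_iff_eq, eq_comm, phi_apply]
    constructor
    · rintro ⟨-, hne', -⟩ hfix; exact hne' (key.2 hfix)
    · intro hfix; exact ⟨hp₂C, fun e => hfix (key.1 e), hp₂α⟩
  by_cases ha : induce σ S d = d <;> by_cases hb : induce σ S (α d) = α d
  · rw [if_neg (fun hh => (i1.1 hh) ha), if_neg (fun hh => (i2.1 hh) hb), if_pos ha, if_pos hb]
    ring
  · rw [if_neg (fun hh => (i1.1 hh) ha), if_pos (i2.2 hb), if_pos ha, if_neg hb]; ring
  · rw [if_pos (i1.2 ha), if_neg (fun hh => (i2.1 hh) hb), if_neg ha, if_pos hb]; ring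
  · rw [if_pos (i1.2 ha), if_pos (i2.2 hb), if_neg ha, if_neg hb]; ring

end FaceSdiff

/-! ## Splitting a cycle by a transposition, union form -/

section Swap

open scoped Classical

/-- **Splitting a cycle, union form**: if `a ≠ b` lie on the SAME cycle of `π`, that cycle is
the union of the `swap a b * π`-cycles of `a` and of `b`. -/
theorem sameCycle_iff_swap_mul_or (π : Perm D) {a b : D} (hne : a ≠ b) (hab : π.SameCycle a b)
    (z : D) : π.SameCycle a z ↔ (swap a b * π).SameCycle a z ∨ (swap a b * π).SameCycle b z := by
  -- in `π' = swap a b * π` the points `a`, `b` are in different cycles, and `swap a b * π' = π`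
  set π' := swap a b * π with hπ'
  have hdiff : ¬ π'.SameCycle a b := not_sameCycle_swap_mul_of_sameCycle π hne hab
  have e : swap a b * π' = π := by rw [hπ', ← mul_assoc, swap_mul_self, one_mul]
  have key := sameCycle_swap_mul_iff_merge π' hdiff a z
  rw [e] at key
  rw [key]
  constructor
  · rintro (h1 | ⟨-, h2⟩)
    · exact Or.inl h1
    · exact h2
  · intro h2
    exact Or.inr ⟨Or.inl (SameCycle.refl _ a), h2⟩

end Swap

end RotSys

end Summit.Ventures.Crystal3D
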